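import Mathlib.MeasureTheory.Integral.IntervalIntegral.Basic
import Literature.Probability.RandomPlanarGeometry.SLEKappaRhoMartingale
import Literature.Probability.RandomPlanarGeometry.LoewnerBoundaryExtension
import Literature.Probability.RandomPlanarGeometry.LoewnerInverse
import Literature.Probability.RandomPlanarGeometry.LoewnerSlitTheorem
import HarnessLib

/-!
# [LSW] proof of Lemma 8.10: `h_t` as the terminal map of a Loewner chain, and (8.3) for `Φ'_{B−y}(0)`

G. F. Lawler, O. Schramm, W. Werner, *Conformal restriction: the chordal case*, J. Amer. Math.
Soc. **16** (2003) 917–955, arXiv:math/0209343 (**[LSW]**), proof of Lemma 8.10: "we realize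
the map `g_{A*} = g_{g_t(A)} = h_t` as a map in a Loewner chain, as follows. Let `β : [0, S] → ℍ̄`
be the smooth path `cl(∂A* ∩ ℍ)` starting from `β(0) = inf(A* ∩ ℝ)` and parametrized by
half-plane capacity from `∞`. Set `ĝ_s = g_{β[0,s]}` and `x_s = ĝ_s(β(s))`. By the chordal version
of Loewner's theorem, `∂_s ĝ_s(z) = 2/(ĝ_s(z) − x_s)`. Then `ĝ_S = h_t`, since both are equal to
the normalized map from `ℍ ∖ g_t(A)` onto `ℍ`. Since `∂_s ĝ_s'(z) = −2ĝ_s'(z)/(ĝ_s(z) − x_s)²`,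
it follows that **(8.3)** `∂_s log ĝ_s'(z) = −2/(ĝ_s(z) − x_s)²`."

This file PROVES the deterministic statement behind this paragraph, in the vocabulary of the
tree (`Loewner.map`, `Loewner.hull`, `Loewner.swallowingTime` of `LoewnerChain`; `hullDeriv`,
`SLEKappaRho.translate` of `SLEKappaRhoMartingale`): if the hull of a continuous driving
function `V` at time `S` is `B ∩ ℍ` for a bounded hull `B`, then for every real point `y ∉ B`
still flowing at time `S`, the map `z ↦ ĝ_S(z + y) − ĝ_S(y)` is a restriction map of the hull
`B − y` seen from `y` (`SLEKappaRho.isRestrictionMap_chainMap`), with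
`Φ'_{B−y}(0) = ĝ_S'(y) = exp(−2 ∫₀^S ds/(ĝ_s(y) − V_s)²)` (`SLEKappaRho.hasRestrictionDeriv_chainMap`,
from the tree's `Loewner.hasDerivAt_map`, the integrated form of (8.3)); hence
`hullDeriv (B − y) = exp(−2 ∫₀^S ds/(ĝ_s(y) − V_s)²)` (`SLEKappaRho.hullDeriv_translate_eq_exp`).
The rate `s ↦ −2/(ĝ_s(y) − V_s)²` (`SLEKappaRho.chainRate`) is continuous on `[0, S]`
(`continuousOn_chainRate`). For an ARC hull `B ∈ 𝒬₊` (a hull bounded by a Jordan arc — the slid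
hulls `g_t(A) − W_t` of a smooth `A` are such) the tree's slit Loewner theorem
`IsArcHull.exists_loewner_chain_holds` (`LoewnerSlitTheorem`) provides such a chain, started at a
real point `V_0 > 0` of `B` (`SLEKappaRho.exists_chain_of_isArcHull`). Also: real translations as
conformal equivalences (`ConformalEquiv.addReal`) and translates of hulls (`IsBoundedHull`,
`IsStarHull`, `IsPlusHull` are invariant under the relevant real translations). The inequalities
(8.2) and the representation (8.4) along such chains are in `SLEKappaRhoChainBounds`.
-/

noncomputable section

open Set Filter MeasureTheory Metric
open scoped NNReal Topology
open UpperHalfPlane (upperHalfPlaneSet isOpen_upperHalfPlaneSet)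

namespace Literature.Probability.RandomPlanarGeometry

/-! ### Real translations as conformal equivalences -/

/-- The real translation `z ↦ z + a` as a conformal equivalence from the translated set
`{z : z + a ∈ U}` onto `U`. [folklore] -/
def ConformalEquiv.addReal (a : ℝ) (U : Set ℂ) : ConformalEquiv ((fun z : ℂ ↦ z + a) ⁻¹' U) U where
  toFun z := z + a
  invFun w := w - a
  source := (fun z : ℂ ↦ z + a) ⁻¹' U
  target := U
  map_source' _ hz := hz
  map_target' w hw := by simpa using hw
  left_inv' z _ := by simp
  right_inv' w _ := by simp
  source_eq := rfl
  target_eq := rfl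
  differentiableOn := differentiableOn_id.add_const _
  differentiableOn_symm := differentiableOn_id.sub_const _

/-- `ConformalEquiv.addReal a U` acts as `z ↦ z + a`. [folklore] -/
@[simp] theorem ConformalEquiv.addReal_apply (a : ℝ) (U : Set ℂ) (z : ℂ) :
    ConformalEquiv.addReal a U z = z + a := rfl

/-- Real translations preserve the upper half-plane. [folklore] -/
theorem preimage_add_real_upperHalfPlaneSet (a : ℝ) :
    (fun z : ℂ ↦ z + a) ⁻¹' upperHalfPlaneSet = upperHalfPlaneSet := by
  ext z
  simp [upperHalfPlaneSet]

namespace SLEKappaRho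

variable {B : Set ℂ}

/-! ### Translates of hulls -/

/-- Membership in `B − x`: `z ∈ B − x ↔ z + x ∈ B`. [folklore] -/
theorem mem_translate_iff {x : ℝ} {z : ℂ} : z ∈ translate B x ↔ z + x ∈ B := by
  simp only [translate, mem_image]
  constructor
  · rintro ⟨b, hb, rfl⟩; simpa using hb
  · intro h; exact ⟨z + x, h, by simp⟩

/-- `B − x` is the preimage of `B` under `z ↦ z + x`. [folklore] -/
theorem translate_eq_preimage (B : Set ℂ) (x : ℝ) : translate B x = (fun z : ℂ ↦ z + x) ⁻¹' B := by
  ext z; exact mem_translate_iff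

/-- `B − x` is the image of `B` under the homeomorphism `z ↦ z + (−x)`. [folklore] -/
theorem translate_eq_image_homeomorph (B : Set ℂ) (x : ℝ) :
    translate B x = (Homeomorph.addRight (-(x : ℂ))) '' B := by
  simp only [translate, Homeomorph.coe_addRight, ← sub_eq_add_neg]

/-- `ℍ ∖ (B − x)` is the translate of `ℍ ∖ B`. [folklore] -/
theorem diff_translate_eq (B : Set ℂ) (x : ℝ) :
    upperHalfPlaneSet \ translate B x = (fun z : ℂ ↦ z + x) ⁻¹' (upperHalfPlaneSet \ B) := by
  rw [preimage_sdiff, preimage_add_real_upperHalfPlaneSet, translate_eq_preimage]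

/-- **Bounded hulls translate**: `B ∈ 𝒬 ⇒ B − x ∈ 𝒬` for real `x`. [folklore] -/
theorem isBoundedHull_translate (hB : IsBoundedHull B) (x : ℝ) :
    IsBoundedHull (translate B x) := by
  set e : ℂ ≃ₜ ℂ := Homeomorph.addRight (-(x : ℂ)) with he
  have himg : translate B x = e '' B := translate_eq_image_homeomorph B x
  have hH : e '' upperHalfPlaneSet = upperHalfPlaneSet := by
    ext z
    simp [he, upperHalfPlaneSet, Homeomorph.coe_addRight]
  refine ⟨?_, ?_, ?_⟩
  · obtain ⟨R, hR⟩ := hB.1.subset_closedBall 0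
    refine (isBounded_closedBall (x := (-(x : ℂ))) (r := R)).subset ?_
    rw [himg]
    rintro _ ⟨b, hb, rfl⟩
    have hb' := hR hb
    rw [mem_closedBall, dist_zero_right] at hb'
    simpa [he, Homeomorph.coe_addRight, mem_closedBall, dist_eq_norm] using hb'
  · rw [himg, ← hH, ← image_inter e.injective, ← e.image_closure, hB.2.1]
  · rw [himg, ← hH, ← image_sdiff e.injective]
    exact e.isSimplyConnected_image.2 hB.2.2

/-- **`*`-hulls translate**: `B ∈ 𝒬`, `x ∉ B` real ⇒ `B − x ∈ 𝒬*`. [folklore] -/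
theorem isStarHull_translate (hB : IsBoundedHull B) {x : ℝ} (hx : (x : ℂ) ∉ B) :
    IsStarHull (translate B x) :=
  ⟨isBoundedHull_translate hB x, fun h ↦ hx (by simpa using mem_translate_iff.1 h)⟩

/-- **`+`-hulls translate to the right**: `B ∈ 𝒬₊`, `x ≤ 0` ⇒ `B − x ∈ 𝒬₊` (the hull seen from a
real point to the left of the origin). [folklore] -/
theorem isPlusHull_translate (hB : IsPlusHull B) {x : ℝ} (hx : x ≤ 0) : IsPlusHull (translate B x) := by
  have hxB : (x : ℂ) ∉ B := fun h ↦ by linarith [hB.2 x h]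
  refine ⟨isStarHull_translate hB.1.isBoundedHull hxB, fun r hr ↦ ?_⟩
  have h := mem_translate_iff.1 hr
  rw [← Complex.ofReal_add] at h
  linarith [hB.2 _ h]

/-! ### Real solutions -/

/-- The maximal solution from a real point, at a time `s ∈ [0, S]` before its swallowing time,
is the real number `re ĝ_s(y)`. [folklore] -/
theorem solution_eq_ofReal {V : ℝ≥0 → ℝ} (hV : Continuous V) {S : ℝ≥0} {y : ℝ} {g : ℝ → ℂ}
    (hg : Loewner.IsSolution V y g (Loewner.swallowingTime V y))
    (hy : (S : WithTop ℝ≥0) < Loewner.swallowingTime V y) {s : ℝ} (hs : s ∈ Icc (0 : ℝ) S) :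
    g s = (((Loewner.map V s.toNNReal y).re : ℝ) : ℂ) := by
  have hsT : ((s.toNNReal : ℝ≥0) : WithTop ℝ≥0) < Loewner.swallowingTime V y :=
    lt_of_le_of_lt (by exact_mod_cast Real.toNNReal_le_iff_le_coe.2 hs.2) hy
  have hgs : g s = Loewner.map V s.toNNReal y := by
    rw [Loewner.map_eq_of_isSolution hV hg hsT, Real.coe_toNNReal _ hs.1]
  have him : (g s).im = 0 := Loewner.IsSolution.im_eq_zero_holds hg (Complex.ofReal_im y) s hs.1
    (by simpa using hsT)
  rw [← hgs]
  exact Complex.ext (by simp) (by simp [him])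

/-! ### The restriction map of the terminal hull of a Loewner chain, seen from a real point -/

section Chain

variable {V : ℝ≥0 → ℝ} (hV : Continuous V) {S : ℝ≥0} (hB : IsBoundedHull B)
  (hhull : Loewner.hull V S = B ∩ upperHalfPlaneSet) {y : ℝ}
  (hy : (S : WithTop ℝ≥0) < Loewner.swallowingTime V y)

/-- The domain `H_S = ℍ ∖ K_S` of the chain is `ℍ ∖ B` when `K_S = B ∩ ℍ`. [folklore] -/
theorem diff_eq_domain (hhull : Loewner.hull V S = B ∩ upperHalfPlaneSet) :
    upperHalfPlaneSet \ B = Loewner.domain V S := by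
  rw [Loewner.domain, hhull, sdiff_inter_self_eq_sdiff]

/-- **The map `z ↦ ĝ_S(z + y) − ĝ_S(y)`** — the terminal Loewner map seen from the real point
`y` — as a conformal equivalence `ℍ ∖ (B − y) → ℍ` (`ĝ_S : H_S → ℍ` is `conformalEquivMap`,
`LoewnerInverse`; `ĝ_S(y)` is real). [cite: LawlerSchrammWerner2003Restriction, proof of Lemma 8.10 (ĝ_S = h_t)] -/
def chainMap (hhull : Loewner.hull V S = B ∩ upperHalfPlaneSet) (y : ℝ) :
    ConformalEquiv (upperHalfPlaneSet \ translate B y) upperHalfPlaneSet :=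
  (((ConformalEquiv.addReal y (upperHalfPlaneSet \ B)).copy _ _ (diff_translate_eq B y) rfl).trans
    (((Loewner.conformalEquivMap hV S).copy _ _ (diff_eq_domain hhull) rfl).trans
      ((ConformalEquiv.addReal (-(Loewner.map V S y).re) upperHalfPlaneSet).copy _ _
        (preimage_add_real_upperHalfPlaneSet _).symm rfl)))

/-- `chainMap` acts as `z ↦ ĝ_S(z + y) − re ĝ_S(y)`. [folklore] -/
theorem chainMap_apply (z : ℂ) :
    chainMap hV hhull y z = Loewner.map V S (z + y) - ((Loewner.map V S y).re : ℂ) := by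
  simp [chainMap, sub_eq_add_neg]

/-- The integrand of (8.3) integrated: `−2/(ĝ_s(y) − V_s)²` along the real flow of `y`.
[cite: LawlerSchrammWerner2003Restriction, proof of Lemma 8.10, (8.3)] -/
def chainRate (V : ℝ≥0 → ℝ) (y : ℝ) (s : ℝ) : ℝ :=
  -2 / ((Loewner.map V s.toNNReal y).re - V s.toNNReal) ^ 2

include hV hy in
/-- **`z ↦ ĝ_S(z + y) − ĝ_S(y)` is a restriction map of `B − y`**: it fixes `0` (continuity of
`ĝ_S` at the flowing real point `y`) and `ĝ_S(z + y) − ĝ_S(y) ∼ z` at `∞` (hydrodynamic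
normalization `ĝ_S(w) − w → 0`, `Loewner.tendsto_map_sub_self_holds`).
[cite: LawlerSchrammWerner2003Restriction, proof of Lemma 8.10 (ĝ_S = h_t, "both are equal to the normalized map")] -/
theorem isRestrictionMap_chainMap : IsRestrictionMap (translate B y) (chainMap hV hhull y) := by
  have hreal : Loewner.map V S y = ((Loewner.map V S y).re : ℂ) := Loewner.map_ofReal_eq hV hy
  set c : ℂ := ((Loewner.map V S y).re : ℂ) with hc
  have happly : ∀ z, chainMap hV hhull y z = Loewner.map V S (z + y) - c := chainMap_apply hV hhull
  constructor
  · -- boundary value `0` at `0`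
    show Tendsto (chainMap hV hhull y) (𝓝[upperHalfPlaneSet \ translate B y] 0) (𝓝 0)
    have hcont : ContinuousAt (Loewner.map V S) y := Loewner.continuousAt_map hV hy
    have h1 : Tendsto (fun z : ℂ ↦ Loewner.map V S (z + y)) (𝓝 0) (𝓝 (Loewner.map V S y)) := by
      have : Tendsto (fun z : ℂ ↦ z + (y : ℂ)) (𝓝 0) (𝓝 (y : ℂ)) := by
        have hc2 : Continuous fun z : ℂ ↦ z + (y : ℂ) := by fun_prop
        have h := hc2.tendsto 0
        rwa [zero_add] at h
      exact hcont.tendsto.comp this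
    have h2 : Tendsto (fun z : ℂ ↦ Loewner.map V S (z + y) - c) (𝓝 0) (𝓝 0) := by
      have := h1.sub_const c
      rwa [hreal, sub_self] at this
    refine (h2.mono_left nhdsWithin_le_nhds).congr fun z ↦ (happly z).symm
  · -- `Ψ z / z → 1` at `∞`
    set F : Filter ℂ := cocompact ℂ ⊓ 𝓟 (upperHalfPlaneSet \ translate B y) with hF
    have hshift : Tendsto (fun z : ℂ ↦ z + (y : ℂ)) F (cocompact ℂ ⊓ 𝓟 upperHalfPlaneSet) := by
      refine Tendsto.inf ?_ (tendsto_principal_principal.2 ?_)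
      · exact (Homeomorph.addRight (y : ℂ)).toCocompactMap.cocompact_tendsto'
      · intro z hz
        rw [diff_translate_eq] at hz
        exact hz.1
    have hsub : Tendsto (fun z : ℂ ↦ Loewner.map V S (z + y) - (z + y)) F (𝓝 0) :=
      (Loewner.tendsto_map_sub_self_holds hV S).comp hshift
    have hinv : Tendsto (fun z : ℂ ↦ z⁻¹) F (𝓝 0) := by
      have h := (tendsto_inv₀_cobounded (α := ℂ))
      rw [Metric.cobounded_eq_cocompact] at h
      exact h.mono_left inf_le_left
    have hlim : Tendsto (fun z : ℂ ↦ 1 + ((Loewner.map V S (z + y) - (z + y)) + ((y : ℂ) - c)) * z⁻¹)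
        F (𝓝 (1 + ((0 + ((y : ℂ) - c)) * 0))) :=
      tendsto_const_nhds.add ((hsub.add tendsto_const_nhds).mul hinv)
    rw [mul_zero, add_zero] at hlim
    have hne : ∀ᶠ z in F, z ≠ 0 :=
      mem_inf_of_left ((isCompact_singleton (x := (0 : ℂ))).compl_mem_cocompact)
    refine hlim.congr' ?_
    filter_upwards [hne] with z hz
    rw [happly z]
    field_simp
    ring

include hV hy in
/-- **(8.3), integrated: `ĝ_S'(y) = exp(−2 ∫₀^S ds/(ĝ_s(y) − V_s)²)`** at a real point `y`
flowing beyond `S` (`Loewner.hasDerivAt_map`: the Loewner map is complex differentiable at every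
flowing point, real ones included, with derivative `exp(−∫₀^S 2 ds/(ĝ_s(y) − V_s)²)`; along the
real flow the integrand is real). [cite: LawlerSchrammWerner2003Restriction, proof of Lemma 8.10, (8.3)] -/
theorem hasDerivAt_map_exp :
    HasDerivAt (Loewner.map V S) ((Real.exp (∫ s in (0 : ℝ)..S, chainRate V y s) : ℝ) : ℂ) y := by
  have hy0 : (y : ℂ) ≠ V 0 := Loewner.ne_driving_of_lt_swallowingTime hy
  obtain ⟨g, hg⟩ := Loewner.exists_isSolution_swallowingTime_holds hV hy0
  have hD := Loewner.hasDerivAt_map hV hy hg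
  have hint : (∫ s in (0 : ℝ)..S, -2 / ((g s - V s.toNNReal) * (g s - V s.toNNReal))) =
      ((∫ s in (0 : ℝ)..S, chainRate V y s : ℝ) : ℂ) := by
    rw [← intervalIntegral.integral_ofReal]
    refine intervalIntegral.integral_congr fun s hs ↦ ?_
    rw [uIcc_of_le S.coe_nonneg] at hs
    simp only [chainRate, solution_eq_ofReal hV hg hy hs]
    push_cast
    ring
  rw [Complex.ofReal_exp, ← hint]
  exact hD

include hV hy in
/-- **`Φ'_{B−y}(0) = ĝ_S'(y) = exp(−2 ∫₀^S ds/(ĝ_s(y) − V_s)²)`** for the restriction map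
`z ↦ ĝ_S(z + y) − ĝ_S(y)` of `B − y`: its difference quotient at `0` is the slope of `ĝ_S` at `y`.
[cite: LawlerSchrammWerner2003Restriction, proof of Lemma 8.10, (8.3)] -/
theorem hasRestrictionDeriv_chainMap :
    HasRestrictionDeriv (translate B y) (chainMap hV hhull y)
      (Real.exp (∫ s in (0 : ℝ)..S, chainRate V y s)) := by
  have hreal : Loewner.map V S y = ((Loewner.map V S y).re : ℂ) := Loewner.map_ofReal_eq hV hy
  have hslope := (hasDerivAt_map_exp hV hy).tendsto_slope_zero
  have heq : (fun z : ℂ ↦ chainMap hV hhull y z / z) =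
      fun t : ℂ ↦ t⁻¹ • (Loewner.map V S ((y : ℂ) + t) - Loewner.map V S y) := by
    funext z
    rw [chainMap_apply, ← hreal, smul_eq_mul, add_comm (y : ℂ) z, div_eq_inv_mul]
  unfold HasRestrictionDeriv
  rw [heq]
  refine hslope.mono_left (nhdsWithin_mono _ ?_)
  rintro z ⟨hz, -⟩ (rfl : z = 0)
  exact absurd hz (by simp [upperHalfPlaneSet])

include hV hhull hy in
/-- **`hullDeriv (B − y) = exp(−2 ∫₀^S ds/(ĝ_s(y) − V_s)²)`**: the number `Φ'_{B−y}(0) = h'(y)` of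
the hull seen from the flowing real point `y ∉ B` is the flow derivative `ĝ_S'(y)` ((8.3) with
"`ĝ_S = h_t`" and the uniqueness of `Φ_{B−y}`).
[cite: LawlerSchrammWerner2003Restriction, proof of Lemma 8.10, (8.3)] -/
theorem hullDeriv_translate_eq_exp (hB : IsBoundedHull B) (hyB : (y : ℂ) ∉ B) :
    hullDeriv (translate B y) = Real.exp (∫ s in (0 : ℝ)..S, chainRate V y s) :=
  hullDeriv_eq (isStarHull_translate hB hyB) (isRestrictionMap_chainMap hV hhull hy)
    (hasRestrictionDeriv_chainMap hV hhull hy)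


/-- **The rate `−2/(ĝ_s(y) − V_s)²` is continuous on `[0, S]`** for a point flowing beyond `S`
(it is the logarithmic derivative `−2/((g − V)(g − V))` of `IsSolution.continuousOn_coeff` along
the real solution). [folklore] -/
theorem continuousOn_chainRate (hV : Continuous V) {y : ℝ}
    (hy : (S : WithTop ℝ≥0) < Loewner.swallowingTime V y) :
    ContinuousOn (chainRate V y) (Icc (0 : ℝ) S) := by
  obtain ⟨g, hg⟩ := Loewner.exists_isSolution_swallowingTime_holds hV
    (Loewner.ne_driving_of_lt_swallowingTime hy)
  have hST : (((S : ℝ).toNNReal : ℝ≥0) : WithTop ℝ≥0) < Loewner.swallowingTime V y := by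
    simpa using hy
  have hc := Loewner.IsSolution.continuousOn_coeff hV hg hg hST hST
  refine (Complex.continuous_re.comp_continuousOn hc).congr fun s hs ↦ ?_
  simp only [Function.comp_apply, chainRate, solution_eq_ofReal hV hg hy hs]
  rw [← Complex.ofReal_sub, ← Complex.ofReal_mul, show (-2 : ℂ) = ((-2 : ℝ) : ℂ) by norm_num,
    ← Complex.ofReal_div, Complex.ofReal_re]
  ring

/-- The rate is interval integrable on `[0, S]`. [folklore] -/
theorem intervalIntegrable_chainRate (hV : Continuous V) {y : ℝ}
    (hy : (S : WithTop ℝ≥0) < Loewner.swallowingTime V y) :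
    IntervalIntegrable (chainRate V y) volume 0 S :=
  (continuousOn_chainRate hV hy).intervalIntegrable_of_Icc S.coe_nonneg

end Chain

/-! ### The Loewner chain of an arc `+`-hull -/

/-- **The Loewner chain of the boundary arc of an arc hull `B ∈ 𝒬₊`** ([LSW] proof of Lemma 8.10:
"Let `β : [0, S] → ℍ̄` be the smooth path `cl(∂A* ∩ ℍ)` […] parametrized by half-plane capacity
from `∞`. Set `ĝ_s = g_{β[0,s]}`"; here from the tree's slit Loewner theorem
`IsArcHull.exists_loewner_chain_holds`, which needs only a Jordan arc): a continuous driving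
function `V` started at a real point `V_0 > 0` of `B` and a time `S > 0` with `K_S = B ∩ ℍ`.
[cite: LawlerSchrammWerner2003Restriction, proof of Lemma 8.10 (the chain ĝ_s)] -/
theorem exists_chain_of_isArcHull (hB : IsArcHull B) (hB' : IsPlusHull B) :
    ∃ (V : ℝ≥0 → ℝ) (S : ℝ≥0), Continuous V ∧ 0 < S ∧ 0 < V 0 ∧
      Loewner.hull V S = B ∩ upperHalfPlaneSet := by
  obtain ⟨-, γ, hγc, hγi, h0, h1, hI, hfr⟩ := id hB
  obtain ⟨V, S, σ, hVc, hS, hV0, -, -, -, -, -, hhull⟩ :=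
    IsArcHull.exists_loewner_chain_holds hB hB' hγc hγi h0 h1 hI hfr
  have hmem : γ 0 ∈ B := IsArcHull.apply_zero_mem hB hγc hfr
  have hre : γ 0 = (((γ 0).re : ℝ) : ℂ) := Complex.ext (by simp) (by simp [h0])
  have hpos : 0 < (γ 0).re := hB'.2 _ (hre ▸ hmem)
  have hV0' : V 0 = (γ 0).re := by
    have := congrArg Complex.re hV0
    simpa using this
  exact ⟨V, S, hVc, hS, hV0' ▸ hpos, hhull⟩

end SLEKappaRho

end Literature.Probability.RandomPlanarGeometry

end
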